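import Summits.Langlands.Langlands.Theses.PicardMuOrdinary
import Summits.Langlands.Langlands.Theorems.PicardMuOrdinaryIrregularClassicalitySlopeFreeReduction
import Summits.Langlands.Langlands.Theorems.PicardMuOrdinaryIrregularClassicalityAvatarTraceLimit
import Summits.Langlands.Langlands.Theorems.PicardMuOrdinaryIrregularClassicalityResidualIrreducibility
import HarnessLib

/-!
# Route `PicardMuOrdinary`, crux `IrregularClassicality` (stmt-Langlands-13758): the Galois witness as the `3`-adic
# trace limit of the tower's avatars — the Picard named fact leaves the crux

Continuation lead prover-line-stmt-Langlands-13758-c14-0, 2026-08-17; line `slope-free-polarized-limit`, skeleton r7/r8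
(`Cruxes/IrregularClassicality/Lines/slope_free_polarized_limit.lean`).  Leads c7–c13 closed the typed crux modulo
THREE statements: the Picard named fact P (`picardCurve_exists_lambdaAdicRep`, residual = Weil 1948 on
`charpoly(Frob | V_ℓ Pic(C_Ω))`), the wall W (`stub_polarizationDebt`) and the heart H (`stub_senClassicalityLinked`)
(`irregularClassicality_of_wall_of_heart`, p141145).  This file removes P:

* `exists_avatarLimit` — the exactly `c₀`-polarized tower that W outputs and H consumes carries Harris–Lan–Taylor–Thorne
  avatars `r_k : Γ_K → GL₃(ℚ̄₃)`, Galois-compatible with `P_k` off `S₀`, whose geometric-Frobenius traces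
  `ι⁻¹(N𝔭 · ΣSat(P_k, 𝔭))` (`trace_inv_of_charpoly_eq_arithFrobPolyOfSatake`) are within `3^{-k}` of
  `ι⁻¹ e(a_𝔭(f) ϖ_𝔭)`.  Taylor's pseudo-representation argument in trace form (registered stub S1 `stub_traceLimit`,
  landed p145892: uniform Cauchy on the dense set of Frobenii — Chebotarev, `frobenius_dense` —, limit pseudocharacter,
  Taylor/Bellaïche–Chenevier, unramifiedness by cyclic stripping + Newton) gives a continuous semisimple
  `ρ : Γ_K → GL₃(ℚ̄₃)` killing the inertia groups off `S₀` with `tr ρ(Frob_𝔭⁻¹) = ι⁻¹ e(a_𝔭 ϖ_𝔭)` there.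
* `isAbsolutelyIrreducible_of_frobTraces` — such a `ρ` is absolutely irreducible for generic `f` (`12 ∣ #Gal(f/ℚ)`): an
  integral model over `ℤ̄₃` (`exists_integralModel_of_valuationSubring`) has reduction `θ` with open kernel
  (`isOpen_ker_residualRep`); at good geometric Frobenii the residual trace is `#Fix − 1` on the four roots of `f_K`
  (registered stub S3 `stub_residualFrobTrace`, p145923: `a_𝔭 ϖ_𝔭 ≡ #roots(f mod 𝔭) − 1 (mod 1 − ω)` and Dedekind's
  dictionary), which is the character of the augmentation representation `(k^{roots})⁰` (registered stub S4
  `stub_augmentationCharacter`, p145900); by density and local constancy the identity holds on all of `Γ_K`; over an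
  algebraic closure of the residue field the augmentation representation is irreducible
  (`augmentationRep_rootSet_map_isIrreducible`, `Gal ⊇ A₄`), so `θ` is irreducible there by trace detection (registered
  stub S2 `stub_traceDetect`, p145915: an equidimensional representation with the traces of an irreducible one over an
  algebraically closed field is irreducible — valid in characteristic `3`), hence absolutely irreducible (Burnside,
  `span_eq_top_of_isIrreducible` + `span_range_map_eq_top_iff` + `span_eq_top_iff_forall_isIrreducible`), and `ρ` is
  absolutely irreducible (Darmon–Diamond–Taylor §2.1, `IsResiduallyAbsIrreducible.isAbsolutelyIrreducible`).
* `avatarLimitWitness` / `stub_avatarLimitWitness` (registered, the lead's stub) — the level `S₀ = S ∪ {v ∣ 3}` and the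
  witness `ρ` with all hypotheses of H, including absolute irreducibility on every quadratic `Γ_L` (Clifford,
  `restrictField_of_finrank_eq_two`).
* `irregularClassicalityPolarized_of_heart'` — **H ALONE closes C3** (`IrregularClassicalityPolarized` of the prepared
  split, spelled out), with Stub 2's Picard witness replaced by the avatar-limit witness and the landed untwist
  `stub_irregularDescentUntwist`; `irregularClassicality_of_wall_of_heart'` — **the typed crux from W and H only**
  (via the landed `irregularClassicality_of_polarized`).

So the crux is W ∘ H with no geometric input: Weil's theorem on the characteristic polynomial of Frobenius leaves this
crux (it stays wanted by 13757's lines).  Nothing here closes the item: W (the `3`-adic descent wall) and H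
(irregular-weight classicality for `U(2,1)` at the ramified prime `3`) are the promoted research statements.

References: R. Taylor, Duke Math. J. 63 (1991) §1; W. Goldring, J.-S. Koskivirta, Invent. Math. 217 (2019) §11.1;
H. Darmon, F. Diamond, R. Taylor, *Fermat's Last Theorem* (1995) §2.1; N. Bourbaki, *Algèbre* VIII §20 n°6; C. Upton,
J. Algebra 322 (2009) §2; M. Harris, K.-W. Lan, R. Taylor, J. Thorne, Res. Math. Sci. 3 (2016) Thm. A.
-/

open Literature.NumberTheory.GaloisRepresentations Literature.NumberTheory.Automorphic
open Literature.RepresentationTheory.Semisimple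
open scoped Pointwise NumberField
open IsDedekindDomain NumberField Polynomial Filter Topology Field

-- `Summit.Langlands.Langlands.…` (summit = sub-problem name, D-0017 layout) trips `dupNamespace` on every decl.
set_option linter.dupNamespace false
set_option autoImplicit false

namespace Summit.Langlands.Langlands.Theorems.IrregularClassicality.SlopeFreePolarizedLimit

noncomputable section

/-! ### Step 4: the witness -/

/-- **The avatar-limit witness.**  From an exactly-polarized avatar tower for the twisted traces `e(a_𝔭 ϖ_𝔭)` off `S`
(the output of W / the input of C3): a level `S₀ = S ∪ {v ∣ 3}` and a continuous `ρ : Γ_K → GL₃(ℚ̄₃)` unramified off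
`S₀` with `tr ρ(Frob_𝔭⁻¹) = ι⁻¹ e(a_𝔭 ϖ_𝔭)` (S1 applied to the avatars, `trace_inv_of_charpoly_eq_arithFrobPolyOfSatake`)
and absolutely irreducible on every quadratic `Γ_L` for generic `f` (S2 + S3 + S4, integral models over `ℤ̄₃`, Burnside,
Clifford). -/
theorem avatarLimitWitness (f : ℤ[X]) (hcpt : isCompact_glFiniteIntegralLevel 3 (CyclotomicField 3 ℚ))
    (hdeg : f.natDegree = 4) (hsep : (f.map (Int.castRingHom ℚ)).Separable)
    (hgal : 12 ∣ Nat.card (f.map (Int.castRingHom ℚ)).Gal)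
    (ι : PadicAlgCl 3 ≃+* ℂ) (e : (CyclotomicField 3 ℚ) →+* ℂ) (S : Finset (HeightOneSpectrum (𝓞 (CyclotomicField 3 ℚ))))
    (c₀ : (CyclotomicField 3 ℚ) ≃ₐ[ℚ] (CyclotomicField 3 ℚ)) (ϖ : HeightOneSpectrum (𝓞 (CyclotomicField 3 ℚ)) → 𝓞 (CyclotomicField 3 ℚ))
    (hϖ : ∀ 𝔭 ∉ S, 𝔭.asIdeal = Ideal.span {ϖ 𝔭} ∧ ϖ 𝔭 - 1 ∈ Ideal.span {(3 : 𝓞 (CyclotomicField 3 ℚ))})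
    (htower : ∀ k : ℕ, ∃ (P : CuspidalAutomorphicRepData 3 (CyclotomicField 3 ℚ) hcpt) (r : FramedGaloisRep (CyclotomicField 3 ℚ) (PadicAlgCl 3) 3),
      P.1.IsRegularAlgebraic ∧ P.1.IsConjSelfDualAE c₀ ∧
      ∀ 𝔭 ∉ S, P.1.IsUnramifiedAt 𝔭 ∧ IsGaloisCompatibleAt P.1 ι r 𝔭 ∧
        ∃ (α : Multiset ℂ) (t : integralClosure ℤ ℂ), P.1.HasSatakeParamAt 𝔭 α ∧
          (t : ℂ) = (𝔭.residueCard : ℂ) * α.sum - e (↑(picardTrace f 𝔭 * ϖ 𝔭)) ∧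
          ‖ι.symm (t : ℂ)‖ ≤ ((3 : ℝ)⁻¹) ^ k) :
    ∃ (S₀ : Finset (HeightOneSpectrum (𝓞 (CyclotomicField 3 ℚ)))) (ρ : FramedGaloisRep (CyclotomicField 3 ℚ) (PadicAlgCl 3) 3),
      (∀ v : HeightOneSpectrum (𝓞 (CyclotomicField 3 ℚ)), ((3 : ℕ) : 𝓞 (CyclotomicField 3 ℚ)) ∈ v.asIdeal → v ∈ S₀) ∧ S ⊆ S₀ ∧
      (∀ 𝔭 ∉ S₀,
        (𝔭.asIdeal = Ideal.span {ϖ 𝔭} ∧ ϖ 𝔭 - 1 ∈ Ideal.span {(3 : 𝓞 (CyclotomicField 3 ℚ))}) ∧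
        ρ.IsUnramifiedAt 𝔭 ∧
        ∀ 𝔓 ∈ 𝔭.primesAbove, ∀ τ : absoluteGaloisGroup (CyclotomicField 3 ℚ), IsArithFrobAt (𝓞 (CyclotomicField 3 ℚ)) τ 𝔓 →
          FramedRep.trace ρ τ⁻¹ = ι.symm (e (↑(picardTrace f 𝔭 * ϖ 𝔭)))) ∧
      (∀ (L : Type) [Field L] [NumberField L] [Algebra (CyclotomicField 3 ℚ) L], Module.finrank (CyclotomicField 3 ℚ) L = 2 →
        FramedRep.IsAbsolutelyIrreducible (ρ.restrictField L)) := by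
  classical
  -- the level `S₀ = S ∪ {v ∣ 3}`
  have hS3 : {v : HeightOneSpectrum (𝓞 (CyclotomicField 3 ℚ)) | ((3 : ℕ) : 𝓞 (CyclotomicField 3 ℚ)) ∈ v.asIdeal}.Finite := by
    have hI : (Ideal.span {((3 : ℕ) : 𝓞 (CyclotomicField 3 ℚ))} : Ideal (𝓞 (CyclotomicField 3 ℚ))) ≠ ⊥ := by
      rw [Ne, Ideal.span_singleton_eq_bot]
      exact_mod_cast (Nat.prime_three).ne_zero
    refine (Ideal.finite_factors hI).subset fun v hv => ?_
    exact Ideal.dvd_iff_le.mpr ((Ideal.span_singleton_le_iff_mem _).mpr hv)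
  set S₀ : Finset (HeightOneSpectrum (𝓞 (CyclotomicField 3 ℚ))) := S ∪ hS3.toFinset with hS₀def
  have hSS₀ : S ⊆ S₀ := Finset.subset_union_left
  have h3S₀ : ∀ v : HeightOneSpectrum (𝓞 (CyclotomicField 3 ℚ)), ((3 : ℕ) : 𝓞 (CyclotomicField 3 ℚ)) ∈ v.asIdeal → v ∈ S₀ := fun v hv =>
    Finset.mem_union_right _ (hS3.mem_toFinset.2 hv)
  -- the tower, read off `S₀`
  have htower' : ∀ k : ℕ, ∃ (P : CuspidalAutomorphicRepData 3 (CyclotomicField 3 ℚ) hcpt) (r : FramedGaloisRep (CyclotomicField 3 ℚ) (PadicAlgCl 3) 3),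
      P.1.IsRegularAlgebraic ∧ P.1.IsConjSelfDualAE c₀ ∧
      ∀ 𝔭 ∉ S₀, P.1.IsUnramifiedAt 𝔭 ∧ IsGaloisCompatibleAt P.1 ι r 𝔭 ∧
        ∃ (α : Multiset ℂ) (t : integralClosure ℤ ℂ), P.1.HasSatakeParamAt 𝔭 α ∧
          (t : ℂ) = (𝔭.residueCard : ℂ) * α.sum - e (↑(picardTrace f 𝔭 * ϖ 𝔭)) ∧
          ‖ι.symm (t : ℂ)‖ ≤ ((3 : ℝ)⁻¹) ^ k := by
    intro k
    obtain ⟨P, r, hreg, hcsd, hP⟩ := htower k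
    exact ⟨P, r, hreg, hcsd, fun 𝔭 h𝔭 => hP 𝔭 fun h => h𝔭 (hSS₀ h)⟩
  obtain ⟨ρ, -, hρ⟩ := exists_avatarLimit f hcpt ι e S₀ c₀ ϖ htower'
  have hϖ' : ∀ 𝔭 ∉ S₀, ϖ 𝔭 - 1 ∈ Ideal.span {(3 : 𝓞 (CyclotomicField 3 ℚ))} := fun 𝔭 h𝔭 => (hϖ 𝔭 fun h => h𝔭 (hSS₀ h)).2
  have habs := isAbsolutelyIrreducible_of_frobTraces f hdeg hsep hgal ι e S₀ ϖ ρ hϖ' fun 𝔭 h𝔭 => (hρ 𝔭 h𝔭).2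
  refine ⟨S₀, ρ, h3S₀, hSS₀, fun 𝔭 h𝔭 => ⟨hϖ 𝔭 fun h => h𝔭 (hSS₀ h), (hρ 𝔭 h𝔭).1, (hρ 𝔭 h𝔭).2⟩,
    fun L _ _ _ hL => ?_⟩
  exact FramedGaloisRep.IsAbsolutelyIrreducible.restrictField_of_finrank_eq_two (by decide) L hL habs

/-! ### The registered stub of the lead (skeleton r7), by name -/

/-- **Registered stub `stub_avatarLimitWitness` of the line `slope-free-polarized-limit` (r7), VERBATIM** — the
avatar-limit witness `avatarLimitWitness`. -/
theorem stub_avatarLimitWitness (f : ℤ[X]) (hcpt : isCompact_glFiniteIntegralLevel 3 (CyclotomicField 3 ℚ))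
    (hdeg : f.natDegree = 4) (hsep : (f.map (Int.castRingHom ℚ)).Separable)
    (hgal : 12 ∣ Nat.card (f.map (Int.castRingHom ℚ)).Gal)
    (ι : PadicAlgCl 3 ≃+* ℂ) (e : (CyclotomicField 3 ℚ) →+* ℂ) (S : Finset (HeightOneSpectrum (𝓞 (CyclotomicField 3 ℚ))))
    (c₀ : (CyclotomicField 3 ℚ) ≃ₐ[ℚ] (CyclotomicField 3 ℚ)) (ϖ : HeightOneSpectrum (𝓞 (CyclotomicField 3 ℚ)) → 𝓞 (CyclotomicField 3 ℚ))
    (hϖ : ∀ 𝔭 ∉ S, 𝔭.asIdeal = Ideal.span {ϖ 𝔭} ∧ ϖ 𝔭 - 1 ∈ Ideal.span {(3 : 𝓞 (CyclotomicField 3 ℚ))})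
    (htower : ∀ k : ℕ, ∃ (P : CuspidalAutomorphicRepData 3 (CyclotomicField 3 ℚ) hcpt) (r : FramedGaloisRep (CyclotomicField 3 ℚ) (PadicAlgCl 3) 3),
      P.1.IsRegularAlgebraic ∧ P.1.IsConjSelfDualAE c₀ ∧
      ∀ 𝔭 ∉ S, P.1.IsUnramifiedAt 𝔭 ∧ IsGaloisCompatibleAt P.1 ι r 𝔭 ∧
        ∃ (α : Multiset ℂ) (t : integralClosure ℤ ℂ), P.1.HasSatakeParamAt 𝔭 α ∧
          (t : ℂ) = (𝔭.residueCard : ℂ) * α.sum - e (↑(picardTrace f 𝔭 * ϖ 𝔭)) ∧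
          ‖ι.symm (t : ℂ)‖ ≤ ((3 : ℝ)⁻¹) ^ k) :
    ∃ (S₀ : Finset (HeightOneSpectrum (𝓞 (CyclotomicField 3 ℚ)))) (ρ : FramedGaloisRep (CyclotomicField 3 ℚ) (PadicAlgCl 3) 3),
      (∀ v : HeightOneSpectrum (𝓞 (CyclotomicField 3 ℚ)), ((3 : ℕ) : 𝓞 (CyclotomicField 3 ℚ)) ∈ v.asIdeal → v ∈ S₀) ∧ S ⊆ S₀ ∧
      (∀ 𝔭 ∉ S₀,
        (𝔭.asIdeal = Ideal.span {ϖ 𝔭} ∧ ϖ 𝔭 - 1 ∈ Ideal.span {(3 : 𝓞 (CyclotomicField 3 ℚ))}) ∧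
        ρ.IsUnramifiedAt 𝔭 ∧
        ∀ 𝔓 ∈ 𝔭.primesAbove, ∀ τ : absoluteGaloisGroup (CyclotomicField 3 ℚ), IsArithFrobAt (𝓞 (CyclotomicField 3 ℚ)) τ 𝔓 →
          FramedRep.trace ρ τ⁻¹ = ι.symm (e (↑(picardTrace f 𝔭 * ϖ 𝔭)))) ∧
      (∀ (L : Type) [Field L] [NumberField L] [Algebra (CyclotomicField 3 ℚ) L], Module.finrank (CyclotomicField 3 ℚ) L = 2 →
        FramedRep.IsAbsolutelyIrreducible (ρ.restrictField L)) :=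
  avatarLimitWitness f hcpt hdeg hsep hgal ι e S c₀ ϖ hϖ htower

/-! ### C3 from the heart H alone; the typed crux from W and H -/

/-- **H alone closes C3** (`IrregularClassicalityPolarized` of the prepared split, VERBATIM the conclusion of the landed
`irregularClassicalityPolarized_of_heart`, WITHOUT its Picard hypothesis): unpack `(e, ι, S, c₀, ϖ, tower)`, take the
avatar-limit witness `(S₀ ⊇ S ∪ {λ}, ρ)` (`avatarLimitWitness`), read the tower off `S₀`, apply H (`ρ` automorphic over
`K`), and untwist (`stub_irregularDescentUntwist`, landed). -/
theorem irregularClassicalityPolarized_of_heart'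
    (hH : ∀ (f : Polynomial ℤ) (hcpt : isCompact_glFiniteIntegralLevel 3 (CyclotomicField 3 ℚ)),
          f.natDegree = 4 → (f.map (Int.castRingHom ℚ)).Separable →
          12 ∣ Nat.card (f.map (Int.castRingHom ℚ)).Gal →
        ∀ (ι : PadicAlgCl 3 ≃+* ℂ) (e : CyclotomicField 3 ℚ →+* ℂ)
          (S₀ : Finset (HeightOneSpectrum (𝓞 (CyclotomicField 3 ℚ))))
          (ϖ : HeightOneSpectrum (𝓞 (CyclotomicField 3 ℚ)) → 𝓞 (CyclotomicField 3 ℚ))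
          (ρ : FramedGaloisRep (CyclotomicField 3 ℚ) (PadicAlgCl 3) 3),
          (∀ v : HeightOneSpectrum (𝓞 (CyclotomicField 3 ℚ)),
            ((3 : ℕ) : 𝓞 (CyclotomicField 3 ℚ)) ∈ v.asIdeal → v ∈ S₀) →
          (∀ 𝔭 ∉ S₀,
            (𝔭.asIdeal = Ideal.span {ϖ 𝔭} ∧
              ϖ 𝔭 - 1 ∈ Ideal.span {(3 : 𝓞 (CyclotomicField 3 ℚ))}) ∧
            ρ.IsUnramifiedAt 𝔭 ∧
            ∀ 𝔓 ∈ 𝔭.primesAbove, ∀ τ : Field.absoluteGaloisGroup (CyclotomicField 3 ℚ),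
              IsArithFrobAt (𝓞 (CyclotomicField 3 ℚ)) τ 𝔓 →
                FramedRep.trace ρ τ⁻¹ = ι.symm (e (↑(picardTrace f 𝔭 * ϖ 𝔭)))) →
          (∀ (L : Type) [Field L] [NumberField L] [Algebra (CyclotomicField 3 ℚ) L],
            Module.finrank (CyclotomicField 3 ℚ) L = 2 →
              FramedRep.IsAbsolutelyIrreducible (ρ.restrictField L)) →
        ∀ (c₀ : CyclotomicField 3 ℚ ≃ₐ[ℚ] CyclotomicField 3 ℚ)
          (S_K : Finset (HeightOneSpectrum (𝓞 (CyclotomicField 3 ℚ)))), c₀ ≠ 1 → S₀ ⊆ S_K →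
          (∀ k : ℕ, ∃ (P : CuspidalAutomorphicRepData 3 (CyclotomicField 3 ℚ) hcpt)
            (r : FramedGaloisRep (CyclotomicField 3 ℚ) (PadicAlgCl 3) 3),
            P.1.IsRegularAlgebraic ∧ P.1.IsConjSelfDualAE c₀ ∧
            ∀ 𝔭 ∉ S_K, P.1.IsUnramifiedAt 𝔭 ∧ IsGaloisCompatibleAt P.1 ι r 𝔭 ∧
              ∃ (α : Multiset ℂ) (t : integralClosure ℤ ℂ), P.1.HasSatakeParamAt 𝔭 α ∧
                (t : ℂ) = (𝔭.residueCard : ℂ) * α.sum - e (↑(picardTrace f 𝔭 * ϖ 𝔭)) ∧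
                ‖ι.symm (t : ℂ)‖ ≤ ((3 : ℝ)⁻¹) ^ k) →
        ∃ (π' : CuspidalAutomorphicRepData 3 (CyclotomicField 3 ℚ) hcpt)
          (S' : Finset (HeightOneSpectrum (𝓞 (CyclotomicField 3 ℚ)))),
          π'.1.IsLAlgebraic ∧
          ∀ 𝔭 ∉ S', ∃ α : Multiset ℂ, π'.1.HasSatakeParamAt 𝔭 α ∧
            ρ.IsUnramifiedAt 𝔭 ∧ ρ.HasFrobCharpolyAt 𝔭 (arithFrobPolyOfSatake ι 𝔭.residueCard 1 α)) :
    ∀ (f : Polynomial ℤ) (hcpt : Literature.NumberTheory.Automorphic.isCompact_glFiniteIntegralLevel 3 (CyclotomicField 3 ℚ)), f.natDegree = 4 → (f.map (Int.castRingHom ℚ)).Separable → 12 ∣ Nat.card (f.map (Int.castRingHom ℚ)).Gal → (∃ (e : (CyclotomicField 3 ℚ) →+* ℂ) (ι : PadicAlgCl 3 ≃+* ℂ) (S : Finset (IsDedekindDomain.HeightOneSpectrum (NumberField.RingOfIntegers (CyclotomicField 3 ℚ)))) (c₀ : (CyclotomicField 3 ℚ) ≃ₐ[ℚ] (CyclotomicField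 3 ℚ)) (ϖ : (IsDedekindDomain.HeightOneSpectrum (NumberField.RingOfIntegers (CyclotomicField 3 ℚ))) → (NumberField.RingOfIntegers (CyclotomicField 3 ℚ))), c₀ ≠ 1 ∧ (∀ 𝔭 ∉ S, 𝔭.asIdeal = Ideal.span {ϖ 𝔭} ∧ ϖ 𝔭 - 1 ∈ Ideal.span {(3 : (NumberField.RingOfIntegers (CyclotomicField 3 ℚ)))}) ∧ ∀ k : ℕ, ∃ (P : Literature.NumberTheory.Automorphic.CuspidalAutomorphicRepData 3 (CyclotomicField 3 ℚ) hcpt) (r : Literature.NumberTheory.GaloisRepresentations.FramedGaloisRep (CyclotomicField 3 ℚ) (PadicAlgCl 3) 3), P.1.IsRegularAlgebraic ∧ P.1.IsConjSelfDualAE c₀ ∧ ∀ 𝔭 ∉ S, P.1.IsUnramifiedAt 𝔭 ∧ Literature.NumberTheory.Automorphic.IsGaloisCompatibleAt P.1 ι r 𝔭 ∧ ∃ (α : Multiset ℂ) (t : (integralClosure ℤ ℂ)), P.1.HasSatakeParamAt 𝔭 α ∧ (t : ℂ) = (𝔭.residueCard : ℂ) * α.sum - e (↑(Literature.NumberTheory.GaloisRepresentations.picardTrace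 f 𝔭 * ϖ 𝔭)) ∧ ‖ι.symm (t : ℂ)‖ ≤ ((3 : ℝ)⁻¹) ^ k) → ∃ (e : (CyclotomicField 3 ℚ) →+* ℂ) (π : Literature.NumberTheory.Automorphic.CuspidalAutomorphicRepData 3 (CyclotomicField 3 ℚ) hcpt), π.1.IsLAlgebraic ∧ ∀ᶠ 𝔭 : IsDedekindDomain.HeightOneSpectrum (NumberField.RingOfIntegers (CyclotomicField 3 ℚ)) in Filter.cofinite, ∃ α : Multiset ℂ, π.1.HasSatakeParamAt 𝔭 α ∧ α.sum = e (Literature.NumberTheory.GaloisRepresentations.picardTrace f 𝔭) := by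
  intro f hcpt hdeg hsep hgal hyp
  classical
  obtain ⟨e, ι, S, c₀, ϖ, hc₀, hϖ, htower⟩ := hyp
  obtain ⟨S₀, ρ, hS₀, hSS₀, hρ, hirr⟩ := avatarLimitWitness f hcpt hdeg hsep hgal ι e S c₀ ϖ hϖ htower
  -- the given tower, read off `S₀ ⊇ S`
  have havat : ∀ k : ℕ, ∃ (P : CuspidalAutomorphicRepData 3 (CyclotomicField 3 ℚ) hcpt)
      (r : FramedGaloisRep (CyclotomicField 3 ℚ) (PadicAlgCl 3) 3),
      P.1.IsRegularAlgebraic ∧ P.1.IsConjSelfDualAE c₀ ∧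
      ∀ 𝔭 ∉ S₀, P.1.IsUnramifiedAt 𝔭 ∧ IsGaloisCompatibleAt P.1 ι r 𝔭 ∧
        ∃ (α : Multiset ℂ) (t : integralClosure ℤ ℂ), P.1.HasSatakeParamAt 𝔭 α ∧
          (t : ℂ) = (𝔭.residueCard : ℂ) * α.sum - e (↑(picardTrace f 𝔭 * ϖ 𝔭)) ∧
          ‖ι.symm (t : ℂ)‖ ≤ ((3 : ℝ)⁻¹) ^ k := by
    intro k
    obtain ⟨P, r, hreg, hcsd, hP⟩ := htower k
    exact ⟨P, r, hreg, hcsd, fun 𝔭 h𝔭 => hP 𝔭 fun h => h𝔭 (hSS₀ h)⟩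
  -- the heart: ρ is automorphic over K
  obtain ⟨π', S'', hLalg, hcompat⟩ :=
    hH f hcpt hdeg hsep hgal ι e S₀ ϖ ρ hS₀ hρ hirr c₀ S₀ hc₀ subset_rfl havat
  -- Stub 6 (landed, unconditional): untwist, in sum form
  obtain ⟨πK, hKalg, hev⟩ :=
    SplitRamifiedPrimeSqrt6.stub_irregularDescentUntwist f hcpt hdeg hsep hgal ι e S₀ ϖ ρ hS₀ hρ π' S'' hLalg hcompat
  exact ⟨e, πK, hKalg, hev⟩

/-- **The typed crux from the wall W and the heart H ONLY** (no Picard named fact, no geometric input): W (registered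
`stub_polarizationDebt`, VERBATIM) then C3 from H (registered `stub_senClassicalityLinked`, VERBATIM) via the landed
glue `irregularClassicality_of_polarized`.  This is the r8 composition `IrregularClassicality_of` of the line
`slope-free-polarized-limit` with its two remaining `sorry`s as hypotheses. -/
theorem irregularClassicality_of_wall_of_heart' : (∀ (f : ℤ[X]) (hcpt : isCompact_glFiniteIntegralLevel 3 (CyclotomicField 3 ℚ)), f.natDegree = 4 → (f.map (Int.castRingHom ℚ)).Separable → 12 ∣ Nat.card (f.map (Int.castRingHom ℚ)).Gal → (∃ (e : CyclotomicField 3 ℚ →+* ℂ) (𝔐 : Ideal (integralClosure ℤ ℂ)) (S : Finset (HeightOneSpectrum (𝓞 (CyclotomicField 3 ℚ)))) (ϖ : HeightOneSpectrum (𝓞 (CyclotomicField 3 ℚ)) → 𝓞 (CyclotomicField 3 ℚ)), 𝔐.IsMaximal ∧ (3 : integralClosure ℤ ℂ) ∈ 𝔐 ∧ (∀ 𝔭 ∉ S, 𝔭.asIdeal = Ideal.span {ϖ 𝔭} ∧ ϖ 𝔭 - 1 ∈ Ideal.span {(3 : 𝓞 (CyclotomicField 3 ℚ))}) ∧ ∀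 k : ℕ, ∃ P : CuspidalAutomorphicRepData 3 (CyclotomicField 3 ℚ) hcpt, P.1.IsRegularAlgebraic ∧ ∀ 𝔭 ∉ S, ∃ (α : Multiset ℂ) (t u : integralClosure ℤ ℂ), P.1.HasSatakeParamAt 𝔭 α ∧ (t : ℂ) = (𝔭.residueCard : ℂ) * α.sum - e (↑(picardTrace f 𝔭 * ϖ 𝔭)) ∧ u ∉ 𝔐 ∧ u * t ∈ Ideal.span {(3 : integralClosure ℤ ℂ) ^ k}) → (∃ (e : CyclotomicField 3 ℚ →+* ℂ) (ι : PadicAlgCl 3 ≃+* ℂ) (S : Finset (HeightOneSpectrum (𝓞 (CyclotomicField 3 ℚ)))) (c₀ : CyclotomicField 3 ℚ ≃ₐ[ℚ] CyclotomicField 3 ℚ) (ϖ : HeightOneSpectrum (𝓞 (CyclotomicField 3 ℚ)) → 𝓞 (CyclotomicField 3 ℚ)), c₀ ≠ 1 ∧ (∀ 𝔭 ∉ S, 𝔭.asIdeal = Ideal.span {ϖ 𝔭} ∧ ϖ 𝔭 - 1 ∈ Ideal.span {(3 : 𝓞 (CyclotomicField 3 ℚ))}) ∧ ∀ k : ℕ,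 ∃ (P : CuspidalAutomorphicRepData 3 (CyclotomicField 3 ℚ) hcpt) (r : FramedGaloisRep (CyclotomicField 3 ℚ) (PadicAlgCl 3) 3), P.1.IsRegularAlgebraic ∧ P.1.IsConjSelfDualAE c₀ ∧ ∀ 𝔭 ∉ S, P.1.IsUnramifiedAt 𝔭 ∧ IsGaloisCompatibleAt P.1 ι r 𝔭 ∧ ∃ (α : Multiset ℂ) (t : integralClosure ℤ ℂ), P.1.HasSatakeParamAt 𝔭 α ∧ (t : ℂ) = (𝔭.residueCard : ℂ) * α.sum - e (↑(picardTrace f 𝔭 * ϖ 𝔭)) ∧ ‖ι.symm (t : ℂ)‖ ≤ ((3 : ℝ)⁻¹) ^ k)) → (∀ (f : ℤ[X]) (hcpt : isCompact_glFiniteIntegralLevel 3 (CyclotomicField 3 ℚ)), f.natDegree = 4 → (f.map (Int.castRingHom ℚ)).Separable → 12 ∣ Nat.card (f.map (Int.castRingHom ℚ)).Gal → ∀ (ι : PadicAlgCl 3 ≃+* ℂ) (e : CyclotomicField 3 ℚ →+* ℂ) (S₀ : Finset (HeightOneSpectrum (𝓞 (CyclotomicField 3 ℚ)))) (ϖ :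 HeightOneSpectrum (𝓞 (CyclotomicField 3 ℚ)) → 𝓞 (CyclotomicField 3 ℚ)) (ρ : FramedGaloisRep (CyclotomicField 3 ℚ) (PadicAlgCl 3) 3), (∀ v : HeightOneSpectrum (𝓞 (CyclotomicField 3 ℚ)), ((3 : ℕ) : 𝓞 (CyclotomicField 3 ℚ)) ∈ v.asIdeal → v ∈ S₀) → (∀ 𝔭 ∉ S₀, (𝔭.asIdeal = Ideal.span {ϖ 𝔭} ∧ ϖ 𝔭 - 1 ∈ Ideal.span {(3 : 𝓞 (CyclotomicField 3 ℚ))}) ∧ ρ.IsUnramifiedAt 𝔭 ∧ ∀ 𝔓 ∈ 𝔭.primesAbove, ∀ τ : Field.absoluteGaloisGroup (CyclotomicField 3 ℚ), IsArithFrobAt (𝓞 (CyclotomicField 3 ℚ)) τ 𝔓 → FramedRep.trace ρ τ⁻¹ = ι.symm (e (↑(picardTrace f 𝔭 * ϖ 𝔭)))) → (∀ (L : Type) [Field L] [NumberField L] [Algebra (CyclotomicField 3 ℚ) L], Module.finrank (CyclotomicField 3 ℚ) L = 2 → FramedRep.IsAbsolutelyIrreducible (ρ.restrictField L)) → ∀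 (c₀ : CyclotomicField 3 ℚ ≃ₐ[ℚ] CyclotomicField 3 ℚ) (S_K : Finset (HeightOneSpectrum (𝓞 (CyclotomicField 3 ℚ)))), c₀ ≠ 1 → S₀ ⊆ S_K → (∀ k : ℕ, ∃ (P : CuspidalAutomorphicRepData 3 (CyclotomicField 3 ℚ) hcpt) (r : FramedGaloisRep (CyclotomicField 3 ℚ) (PadicAlgCl 3) 3), P.1.IsRegularAlgebraic ∧ P.1.IsConjSelfDualAE c₀ ∧ ∀ 𝔭 ∉ S_K, P.1.IsUnramifiedAt 𝔭 ∧ IsGaloisCompatibleAt P.1 ι r 𝔭 ∧ ∃ (α : Multiset ℂ) (t : integralClosure ℤ ℂ), P.1.HasSatakeParamAt 𝔭 α ∧ (t : ℂ) = (𝔭.residueCard : ℂ) * α.sum - e (↑(picardTrace f 𝔭 * ϖ 𝔭)) ∧ ‖ι.symm (t : ℂ)‖ ≤ ((3 : ℝ)⁻¹) ^ k) → ∃ (π' : CuspidalAutomorphicRepData 3 (CyclotomicField 3 ℚ) hcpt) (S' : Finset (HeightOneSpectrum (𝓞 (CyclotomicField 3 ℚ)))), π'.1.IsLAlgebraic ∧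 ∀ 𝔭 ∉ S', ∃ α : Multiset ℂ, π'.1.HasSatakeParamAt 𝔭 α ∧ ρ.IsUnramifiedAt 𝔭 ∧ ρ.HasFrobCharpolyAt 𝔭 (arithFrobPolyOfSatake ι 𝔭.residueCard 1 α)) → Summit.Langlands.Langlands.Theses.PicardMuOrdinary.IrregularClassicality :=
  fun hW hH => irregularClassicality_of_polarized hW (irregularClassicalityPolarized_of_heart' hH)

end

end Summit.Langlands.Langlands.Theorems.IrregularClassicality.SlopeFreePolarizedLimit
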